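import Literature.MathematicalPhysics.QuantumLattice.HeisenbergGroundStateSymmetry
import Literature.MathematicalPhysics.QuantumLattice.SymmetryOrbitBasis
import HarnessLib

/-!
# Soundness of the symmetry-reduced (orbit-basis) Kato–Temple certificate for the Heisenberg
# antiferromagnet: one assembled theorem

Topic `MathematicalPhysics/QuantumLattice` (family `hubbard`). This file assembles
`GroundStateEnclosureCertificate.lean` (Kato–Temple enclosure in a sector `K`, LDLᵀ / frame gap
certificates), `HeisenbergGroundStateSymmetry.lean` (Marshall–Lieb–Mattis: the ground state of the
bipartite antiferromagnet with `|A| = |Aᶜ|` is unique, lies in `Sᶻ = 0` and is fixed by the lattice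
symmetries and the spin flip) and `SymmetryOrbitBasis.lean` (invariant vectors are spanned by orbit
indicators) into the two statements that a symmetry-reduced exact-diagonalisation certificate
actually uses:

* `TempleKato.groundState_enclosure_of_block_certificate` /
  `TempleKato.groundState_expectation_of_block_certificate` (any Hermitian `A`): if the ground space
  lies in an `A`-invariant subspace `K` spanned by the columns of a frame `Φ` (columns in `K`), then
  an exact factorisation `Φᴴ A Φ - s Φᴴ Φ = L·diag(d)·Lᴴ` with all pivots but one nonnegative,
  together with the Rayleigh data `N = ‖Φc‖²`, `ρ N = Re⟨Φc, AΦc⟩`, `‖AΦc‖² ≤ (r2 + ρ²) N`, `ρ < s`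
  of a block trial vector `c`, proves `ρ - r2/(s-ρ) ≤ E₀(A) ≤ ρ`, uniqueness of the ground state,
  the overlap bound `(N - |⟨ψ₀, Φc⟩|²)(s-ρ)² ≤ r2 N`, and for every observable with
  `|⟨x,(O - m)x⟩| ≤ h‖x‖²` the bound `|Re ω₀(O) - Re⟨Φc, OΦc⟩/N| ≤ 2h(β + β²)` whenever
  `r2 ≤ β²(s-ρ)²`.
* `TempleKato.groundEnergy_ge_of_block_psd_certificate`: all pivots `≥ 0` at shift `s` ⇒ `s ≤ E₀`
  (the inertia-zero half of the Sturm enclosure); `TempleKato.groundEnergy_lt_of_negative_pivot`: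
  a negative pivot `d j < 0` with the witness `Lᴴ y = e_j` ⇒ `E₀ < s` (any Hermitian `A`).
* `LiebMattis.orbitBlock_structure`, `LiebMattis.orbitBlock_certificate`,
  `LiebMattis.orbitBlock_psd_lower`, `LiebMattis.orbitBlock_expectation_certificate`
  (and the `_of_invariant` variants taking the trial vector `w` in the full basis, exactly
  invariant under the generators — the shape of an integer-symmetrised Lanczos vector)
  (the Heisenberg antiferromagnet `H = heisenbergHamiltonian n G J`, `G` connected and bipartite in
  `A`, `Aᶜ`, `J > 0`, `|Aᶜ| = |A|`): for a set `S` of configuration symmetries each of which is the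
  relabelling `configPerm e` by a graph automorphism mapping `A` onto `A`, or onto `Aᶜ` with `|A|·n`
  even, or the spin flip with `|A|·n` even, and the ORBIT FRAME `Φ σ k = 𝟙[σ ∈ orbit (rep k)]` of a
  list `rep` of weight-`|Aᶜ|n` representatives meeting every orbit of the generated group in that
  weight sector, the same certificate data prove the same conclusions for `H.groundEnergy`,
  `H.HasUniqueGroundState` and `H.groundStateFunctional` — with NO residual hypothesis on the
  ground state: the subspace `K = {v ∈ 𝓗_{Sᶻ=0} | v ∘ g = v ∀ g ∈ S}` is `H`-invariant, contains
  the ground space (Marshall–Lieb–Mattis), contains the columns of `Φ` and is spanned by them.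

What remains instance-specific (and is checked in exact arithmetic per certificate row) is only:
the integer block matrices are `Φᴴ H Φ`, `Φᴴ Φ` (and `Φᴴ O Φ`), the LDLᵀ identity, the Rayleigh
sums, and the completeness of the representative list.

References: Kato (1949) Thm 1 / Temple (1928) [Kato1949, Temple1928]; Lieb–Mattis (1962) Thm 2
[LiebMattis1962]; Marshall (1955) [Marshall1955]; Golub–Van Loan (2013) §8.1.5 (inertia /
LDLᵀ) [GolubVanLoan2013]; Tasaki (2020) §2.1, §2.4 [Tasaki2020].
-/

noncomputable section

open Matrix Finset
open scoped ComplexOrder BigOperators ComplexConjugate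

namespace Literature.MathematicalPhysics.QuantumLattice

/-! ### Generic: a block certificate in a subspace containing the ground space -/

namespace TempleKato

open EigenvalueContinuation

variable {ι : Type*} [Fintype ι] [DecidableEq ι] {κ : Type*} [Fintype κ] [DecidableEq κ]

/-- **Ground-state enclosure from a block (frame) certificate.** `A` Hermitian; `K` an
`A`-invariant subspace containing the ground space; `Φ` a frame with columns in `K` spanning `K`;
`Φᴴ A Φ - s Φᴴ Φ = L diag(d) Lᴴ` with `d i ≥ 0` for `i ≠ j`; a block trial vector `c` with
`‖Φc‖² = N > 0`, `Re⟨Φc, AΦc⟩ = ρ N`, `‖AΦc‖² ≤ (r2 + ρ²) N`, `ρ < s`. Then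
`ρ - r2/(s-ρ) ≤ E₀ ≤ ρ`, the ground state `ψ₀` is unique, `ω₀(O) = ⟨ψ₀, O ψ₀⟩`, and
`(N - |⟨ψ₀, Φc⟩|²)(s-ρ)² ≤ r2 N`. Kato (1949) Thm 1; Golub–Van Loan (2013) Thm 8.1.17.
[cite: Kato1949, Theorem 1] -/
theorem groundState_enclosure_of_block_certificate [Nonempty ι] {A : Matrix ι ι ℂ}
    (hA : A.IsHermitian) (K : Submodule ℂ (ι → ℂ)) (hKA : ∀ v ∈ K, A *ᵥ v ∈ K)
    (hGS : A.groundSpace ≤ K) (Φ : Matrix ι κ ℂ) (hΦK : ∀ y, Φ *ᵥ y ∈ K)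
    (hKΦ : ∀ x ∈ K, ∃ y, Φ *ᵥ y = x) {s : ℝ} (L : Matrix κ κ ℂ) (d : κ → ℝ) (j : κ)
    (hfac : Φᴴ * A * Φ - (s : ℂ) • (Φᴴ * Φ) = L * diagonal (fun i => (d i : ℂ)) * Lᴴ)
    (hd : ∀ i, i ≠ j → 0 ≤ d i) (c : κ → ℂ) {N ρ r2 : ℝ} (hN : 0 < N)
    (hwN : (star (Φ *ᵥ c) ⬝ᵥ (Φ *ᵥ c)).re = N)
    (hρ : (star (Φ *ᵥ c) ⬝ᵥ A *ᵥ (Φ *ᵥ c)).re = ρ * N)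
    (hr2 : (star (A *ᵥ (Φ *ᵥ c)) ⬝ᵥ A *ᵥ (Φ *ᵥ c)).re ≤ (r2 + ρ ^ 2) * N) (hρs : ρ < s) :
    ρ - r2 / (s - ρ) ≤ A.groundEnergy ∧ A.groundEnergy ≤ ρ ∧ A.HasUniqueGroundState ∧
      ∃ ψ : ι → ℂ, ψ ∈ K ∧ star ψ ⬝ᵥ ψ = 1 ∧ A *ᵥ ψ = ((A.groundEnergy : ℝ) : ℂ) • ψ ∧
        (∀ O : Matrix ι ι ℂ, A.groundStateFunctional O = star ψ ⬝ᵥ O *ᵥ ψ) ∧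
        (N - ‖star ψ ⬝ᵥ (Φ *ᵥ c)‖ ^ 2) * (s - ρ) ^ 2 ≤ r2 * N := by
  obtain ⟨W, u, hW, hWK⟩ := exists_codimOne_of_frame_certificate (A := A) K Φ hKΦ (fun i => L i j)
    (fun y hy => frame_form_ge_of_ldl_certificate Φ j hfac hd y hy)
  obtain ⟨hlo, hhi, ψ, hψK, hψ1, hAψ, huniq, -, hover⟩ :=
    sector_enclosure_of_sums hA K hKA hW hWK (hΦK c) hN hwN hρ hr2 hρs
  have hE := minEnergyOn_eq_groundEnergy_of_groundSpace_le hA hGS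
  obtain ⟨hfin, hstate⟩ := projState_sectorGroundProj_eq K hψK hψ1 hAψ huniq
  obtain ⟨hGSeq, -, hfun⟩ := sectorGroundProj_eq_groundProj_of_groundSpace_le hA hGS
  rw [hE] at hlo hhi hAψ
  refine ⟨hlo, hhi, ?_, ψ, hψK, hψ1, hAψ, fun O => ?_, hover⟩
  · rw [Matrix.HasUniqueGroundState]
    rw [hGSeq] at hfin
    exact_mod_cast hfin
  · rw [← hfun, hstate O]

/-- **Ground-state expectation from a block certificate.** Under the hypotheses of
`groundState_enclosure_of_block_certificate`, for an observable `O` with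
`|⟨x, (O - m) x⟩| ≤ h ‖x‖²` and `r2 ≤ β² (s-ρ)²`, `β ≥ 0`:
`|Re ω₀(O) - Re⟨Φc, O Φc⟩ / N| ≤ 2 h (β + β²)`. Kato (1949); the mixing estimate of
`TempleKato.abs_expect_sub_expect_le`. [cite: Kato1949, Theorem 1] -/
theorem groundState_expectation_of_block_certificate [Nonempty ι] {A : Matrix ι ι ℂ}
    (hA : A.IsHermitian) (K : Submodule ℂ (ι → ℂ)) (hKA : ∀ v ∈ K, A *ᵥ v ∈ K)
    (hGS : A.groundSpace ≤ K) (Φ : Matrix ι κ ℂ) (hΦK : ∀ y, Φ *ᵥ y ∈ K)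
    (hKΦ : ∀ x ∈ K, ∃ y, Φ *ᵥ y = x) {s : ℝ} (L : Matrix κ κ ℂ) (d : κ → ℝ) (j : κ)
    (hfac : Φᴴ * A * Φ - (s : ℂ) • (Φᴴ * Φ) = L * diagonal (fun i => (d i : ℂ)) * Lᴴ)
    (hd : ∀ i, i ≠ j → 0 ≤ d i) (c : κ → ℂ) {N ρ r2 : ℝ} (hN : 0 < N)
    (hwN : (star (Φ *ᵥ c) ⬝ᵥ (Φ *ᵥ c)).re = N)
    (hρ : (star (Φ *ᵥ c) ⬝ᵥ A *ᵥ (Φ *ᵥ c)).re = ρ * N)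
    (hr2 : (star (A *ᵥ (Φ *ᵥ c)) ⬝ᵥ A *ᵥ (Φ *ᵥ c)).re ≤ (r2 + ρ ^ 2) * N) (hρs : ρ < s)
    {O : Matrix ι ι ℂ} {m h β : ℝ}
    (hOform : ∀ x : ι → ℂ, ‖star x ⬝ᵥ O *ᵥ x - (m : ℂ) * (star x ⬝ᵥ x)‖ ≤ h * (star x ⬝ᵥ x).re)
    (hβ : 0 ≤ β) (hβr : r2 ≤ β ^ 2 * (s - ρ) ^ 2) :
    |(A.groundStateFunctional O).re - (star (Φ *ᵥ c) ⬝ᵥ O *ᵥ (Φ *ᵥ c)).re / N| ≤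
      2 * h * (β + β ^ 2) := by
  obtain ⟨W, u, hW, hWK⟩ := exists_codimOne_of_frame_certificate (A := A) K Φ hKΦ (fun i => L i j)
    (fun y hy => frame_form_ge_of_ldl_certificate Φ j hfac hd y hy)
  set w : ι → ℂ := Φ *ᵥ c with hw
  have hw0 : w ≠ 0 := by
    rintro h0
    rw [h0, dotProduct_zero, Complex.zero_re] at hwN
    exact hN.ne' hwN.symm
  obtain ⟨a, ha, haa, ha1⟩ := exists_normalize hw0
  rw [hwN] at haa
  have hw'K : (a : ℂ) • w ∈ K := K.smul_mem _ (hΦK c)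
  have hρ' : (star ((a : ℂ) • w) ⬝ᵥ A *ᵥ ((a : ℂ) • w)).re = ρ := by
    rw [mulVec_smul, star_real_smul_dotProduct_real_smul, Complex.re_ofReal_mul, hρ, ← mul_assoc,
      mul_comm (a * a), mul_assoc, haa, mul_one]
  have hr2' : (star (A *ᵥ ((a : ℂ) • w)) ⬝ᵥ A *ᵥ ((a : ℂ) • w)).re ≤ r2 + ρ ^ 2 := by
    rw [mulVec_smul, star_real_smul_dotProduct_real_smul, Complex.re_ofReal_mul]
    calc a * a * (star (A *ᵥ w) ⬝ᵥ A *ᵥ w).re ≤ a * a * ((r2 + ρ ^ 2) * N) :=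
          mul_le_mul_of_nonneg_left hr2 (mul_self_nonneg a)
      _ = r2 + ρ ^ 2 := by rw [mul_comm (r2 + ρ ^ 2), ← mul_assoc, haa, one_mul]
  have hmain := sector_expectation_enclosure hA K hKA hW hWK hw'K ha1 hρ' hr2' hρs hOform hβ hβr
  obtain ⟨-, -, hfun⟩ := sectorGroundProj_eq_groundProj_of_groundSpace_le hA hGS
  rw [hfun, mulVec_smul, star_real_smul_dotProduct_real_smul, Complex.re_ofReal_mul] at hmain
  have hdiv : (star w ⬝ᵥ O *ᵥ w).re / N = a * a * (star w ⬝ᵥ O *ᵥ w).re := by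
    rw [div_eq_iff hN.ne', mul_comm (a * a), mul_assoc, haa, mul_one]
  rw [hdiv]
  exact hmain

/-- The `LDLᴴ` form with ALL pivots nonnegative is nonnegative everywhere:
`Re ⟨y, L D Lᴴ y⟩ = Σ_i d_i |(Lᴴ y)_i|² ≥ 0`. Golub–Van Loan (2013) §4.1 / §8.1.5. [folklore] -/
theorem re_ldl_form_nonneg_of_nonneg (L : Matrix κ κ ℂ) {d : κ → ℝ} (hd : ∀ i, 0 ≤ d i)
    (y : κ → ℂ) : 0 ≤ (star y ⬝ᵥ (L * diagonal (fun i => (d i : ℂ)) * Lᴴ) *ᵥ y).re := by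
  have hss : ∀ a : ℂ, star a * a = ((‖a‖ ^ 2 : ℝ) : ℂ) := fun a => by
    rw [Complex.star_def, ← Complex.normSq_eq_conj_mul_self, Complex.normSq_eq_norm_sq]
  rw [← mulVec_mulVec, ← mulVec_mulVec, RayleighBottom.star_dotProduct_mulVec_eq]
  set u := Lᴴ *ᵥ y with hu
  have hsum : star u ⬝ᵥ diagonal (fun i => (d i : ℂ)) *ᵥ u = ∑ i, ((d i * ‖u i‖ ^ 2 : ℝ) : ℂ) := by
    simp only [dotProduct, mulVec_diagonal, Pi.star_apply]
    refine Finset.sum_congr rfl fun i _ => ?_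
    rw [mul_left_comm, hss, ← Complex.ofReal_mul]
  rw [hsum, ← Complex.ofReal_sum, Complex.ofReal_re]
  exact Finset.sum_nonneg fun i _ => mul_nonneg (hd i) (sq_nonneg _)

omit [DecidableEq ι] in
/-- **Frame PSD (inertia-zero) certificate**: `Φᴴ A Φ - s Φᴴ Φ = L diag(d) Lᴴ` with all `d i ≥ 0`
gives `Re ⟨Φ y, A Φ y⟩ ≥ s ‖Φ y‖²` for every `y` (no negative pivot of `M - s G` ⇒ no eigenvalue
of the block pencil below `s`). Golub–Van Loan (2013) Thm 8.1.17. [cite: GolubVanLoan2013, §8.1.5 Thm 8.1.17] -/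
theorem frame_form_ge_of_psd_certificate {A : Matrix ι ι ℂ} (Φ : Matrix ι κ ℂ)
    {L : Matrix κ κ ℂ} {d : κ → ℝ} {s : ℝ}
    (hfac : Φᴴ * A * Φ - (s : ℂ) • (Φᴴ * Φ) = L * diagonal (fun i => (d i : ℂ)) * Lᴴ)
    (hd : ∀ i, 0 ≤ d i) (y : κ → ℂ) :
    s * (star (Φ *ᵥ y) ⬝ᵥ (Φ *ᵥ y)).re ≤ (star (Φ *ᵥ y) ⬝ᵥ A *ᵥ (Φ *ᵥ y)).re := by
  have h := re_ldl_form_nonneg_of_nonneg L hd y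
  rw [← hfac, sub_mulVec, smul_mulVec, dotProduct_sub, dotProduct_smul, smul_eq_mul, ← frame_form,
    ← frame_norm, Complex.sub_re, Complex.re_ofReal_mul] at h
  linarith

/-- **Lower bound on the ground energy from a block PSD certificate.** If the ground space lies in a
subspace `K` spanned by the columns of `Φ` and `Φᴴ A Φ - s Φᴴ Φ = L diag(d) Lᴴ` with all pivots
`≥ 0`, then `s ≤ E₀(A)` (a ground-state vector is `Φ y`, and `s ‖Φy‖² ≤ ⟨Φy, AΦy⟩ = E₀ ‖Φy‖²`).
With an exact factorisation at a second shift having ONE negative pivot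
(`groundState_enclosure_of_block_certificate`, or a Rayleigh quotient `< s₁`) this is the
Sturm/inertia-count enclosure `s₀ ≤ E₀ ≤ s₁` of symmetry-reduced exact diagonalisation.
[cite: GolubVanLoan2013, §8.1.5 Thm 8.1.17] -/
theorem groundEnergy_ge_of_block_psd_certificate [Nonempty ι] {A : Matrix ι ι ℂ}
    (hA : A.IsHermitian) (K : Submodule ℂ (ι → ℂ)) (hGS : A.groundSpace ≤ K) (Φ : Matrix ι κ ℂ)
    (hKΦ : ∀ x ∈ K, ∃ y, Φ *ᵥ y = x) {s : ℝ} (L : Matrix κ κ ℂ) (d : κ → ℝ)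
    (hfac : Φᴴ * A * Φ - (s : ℂ) • (Φᴴ * Φ) = L * diagonal (fun i => (d i : ℂ)) * Lᴴ)
    (hd : ∀ i, 0 ≤ d i) : s ≤ A.groundEnergy := by
  obtain ⟨ψ, hψ, hψ0⟩ := (Submodule.ne_bot_iff _).1 (Matrix.groundSpace_ne_bot_holds hA)
  obtain ⟨y, rfl⟩ := hKΦ ψ (hGS hψ)
  have hAψ := (Matrix.mem_groundSpace_iff A _).1 hψ
  have h := frame_form_ge_of_psd_certificate Φ hfac hd y
  rw [re_star_dotProduct_mulVec_of_eigen hAψ] at h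
  exact le_of_mul_le_mul_right h (re_star_dotProduct_self_pos hψ0)

omit [DecidableEq ι] in
/-- **Negative-pivot witness**: if `Φᴴ A Φ - s Φᴴ Φ = L diag(d) Lᴴ`, `d j < 0`, and `y` solves
`Lᴴ y = e_j` (always solvable when `L` is unit lower triangular; the solution is part of the
certificate), then the Rayleigh quotient of `Φ y` is `< s`: `Re ⟨Φy, AΦy⟩ - s ‖Φy‖² = d j < 0`. This is
the easy direction of "one negative pivot at shift `s` ⇒ an eigenvalue below `s`" (Sylvester;
Golub–Van Loan Thm 8.1.17). [cite: GolubVanLoan2013, §8.1.5 Thm 8.1.17] -/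
theorem frame_form_lt_of_negative_pivot {A : Matrix ι ι ℂ} (Φ : Matrix ι κ ℂ)
    {L : Matrix κ κ ℂ} {d : κ → ℝ} {s : ℝ}
    (hfac : Φᴴ * A * Φ - (s : ℂ) • (Φᴴ * Φ) = L * diagonal (fun i => (d i : ℂ)) * Lᴴ)
    {j : κ} (hdj : d j < 0) (y : κ → ℂ) (hy : Lᴴ *ᵥ y = Pi.single j 1) :
    (star (Φ *ᵥ y) ⬝ᵥ A *ᵥ (Φ *ᵥ y)).re < s * (star (Φ *ᵥ y) ⬝ᵥ (Φ *ᵥ y)).re := by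
  have hform : star y ⬝ᵥ (L * diagonal (fun i => (d i : ℂ)) * Lᴴ) *ᵥ y = (d j : ℂ) := by
    rw [← mulVec_mulVec, ← mulVec_mulVec, RayleighBottom.star_dotProduct_mulVec_eq, hy]
    simp [mulVec_diagonal, dotProduct, Pi.single_apply]
  have h : (star y ⬝ᵥ (Φᴴ * A * Φ - (s : ℂ) • (Φᴴ * Φ)) *ᵥ y).re = d j := by
    rw [hfac, hform, Complex.ofReal_re]
  rw [sub_mulVec, smul_mulVec, dotProduct_sub, dotProduct_smul, smul_eq_mul, ← frame_form,
    ← frame_norm, Complex.sub_re, Complex.re_ofReal_mul] at h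
  linarith

/-- **Upper bound on the ground energy from a negative pivot**: under the hypotheses of
`frame_form_lt_of_negative_pivot` (any Hermitian `A`, no symmetry needed), `E₀(A) < s`. With
`groundEnergy_ge_of_block_psd_certificate` at a smaller shift this is the two-sided Sturm /
inertia-count enclosure of `E₀` of symmetry-reduced exact diagonalisation.
[cite: GolubVanLoan2013, §8.1.5 Thm 8.1.17] -/
theorem groundEnergy_lt_of_negative_pivot {A : Matrix ι ι ℂ} (hA : A.IsHermitian) (Φ : Matrix ι κ ℂ)
    {L : Matrix κ κ ℂ} {d : κ → ℝ} {s : ℝ}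
    (hfac : Φᴴ * A * Φ - (s : ℂ) • (Φᴴ * Φ) = L * diagonal (fun i => (d i : ℂ)) * Lᴴ)
    {j : κ} (hdj : d j < 0) (y : κ → ℂ) (hy : Lᴴ *ᵥ y = Pi.single j 1) :
    A.groundEnergy < s := by
  have hlt := frame_form_lt_of_negative_pivot Φ hfac hdj y hy
  set x : ι → ℂ := Φ *ᵥ y with hx
  have hx0 : x ≠ 0 := by
    intro h0
    rw [h0, mulVec_zero, dotProduct_zero, Complex.zero_re, mul_zero] at hlt
    exact lt_irrefl _ hlt
  obtain ⟨a, ha, haa, ha1⟩ := exists_normalize hx0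
  have hpos := re_star_dotProduct_self_pos hx0
  have hE := Matrix.groundEnergy_le_rayleigh_holds hA ((a : ℂ) • x) ha1
  rw [mulVec_smul, star_real_smul_dotProduct_real_smul, Complex.re_ofReal_mul] at hE
  -- `E₀ ≤ a² Re⟨x,Ax⟩ < a² s ‖x‖² = s`
  have haa0 : 0 < a * a := mul_pos ha ha
  have h2 : a * a * (star x ⬝ᵥ A *ᵥ x).re < a * a * (s * (star x ⬝ᵥ x).re) :=
    mul_lt_mul_of_pos_left hlt haa0
  have h3 : a * a * (s * (star x ⬝ᵥ x).re) = s := by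
    calc a * a * (s * (star x ⬝ᵥ x).re) = s * (a * a * (star x ⬝ᵥ x).re) := by ring
      _ = s := by rw [haa, mul_one]
  linarith

end TempleKato

/-! ### The Heisenberg antiferromagnet in the orbit basis of a lattice symmetry group -/

namespace LiebMattis

open TempleKato EigenvalueContinuation

variable {Λ : Type*} [Fintype Λ] [DecidableEq Λ] (n : ℕ) (G : SimpleGraph Λ) [DecidableRel G.Adj]
  (A : Finset Λ) (J : ℝ)

omit [DecidableEq Λ] in
/-- Weight of the flipped configuration: `Σ_z (n - σ_z) + Σ_z σ_z = |Λ| n`. [folklore] -/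
theorem weight_flipCfg_add (σ : TensorIndex Λ (n + 1)) :
    (∑ z, ((flipCfg σ z : Fin (n + 1)) : ℕ)) + ∑ z, (σ z : ℕ) = Fintype.card Λ * n := by
  rw [← Finset.sum_add_distrib]
  have h : ∀ z ∈ (Finset.univ : Finset Λ), ((flipCfg σ z : Fin (n + 1)) : ℕ) + (σ z : ℕ) = n := by
    intro z _
    simp only [flipCfg, Fin.val_rev]
    have := (σ z).isLt
    omega
  rw [Finset.sum_congr rfl h, Finset.sum_const, Finset.card_univ, smul_eq_mul]

omit [Fintype Λ] [DecidableEq Λ] in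
/-- A predicate on configurations invariant under a generating set of permutations is invariant
under the generated subgroup. [folklore] -/
theorem iff_perm_of_generators {X : Type*} (S : Set (Equiv.Perm X)) (P : X → Prop)
    (hP : ∀ g ∈ S, ∀ x, P (g x) ↔ P x) {g : Equiv.Perm X} (hg : g ∈ Subgroup.closure S) (x : X) :
    P (g x) ↔ P x := by
  induction hg using Subgroup.closure_induction generalizing x with
  | mem g hg => exact hP g hg x
  | one => exact Iff.rfl
  | mul g h _ _ ihg ihh => rw [Equiv.Perm.mul_apply, ihg, ihh]
  | inv g _ ih =>
    have h := ih (g⁻¹ x)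
    rw [Equiv.Perm.inv_def, Equiv.apply_symm_apply] at h
    exact h.symm

omit [Fintype Λ] [DecidableEq Λ] in
/-- Orbits are stable under the group: `h • a ∈ orbit b ↔ a ∈ orbit b`. [folklore] -/
theorem smul_mem_orbit_iff {X Gp : Type*} [Group Gp] [MulAction Gp X] (h : Gp) {a b : X} :
    h • a ∈ MulAction.orbit Gp b ↔ a ∈ MulAction.orbit Gp b := by
  have key : ∀ (k : Gp) (a : X), a ∈ MulAction.orbit Gp b → k • a ∈ MulAction.orbit Gp b := by
    intro k a ha
    rw [← MulAction.orbit_eq_iff.2 ha]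
    exact MulAction.mem_orbit a k
  refine ⟨fun hh => ?_, key h a⟩
  have := key h⁻¹ _ hh
  rwa [inv_smul_smul] at this

/-- **The symmetric block of the Heisenberg antiferromagnet and its orbit frame.** `H = J Σ 𝐒_x·𝐒_y`
(`J > 0`) on a connected graph bipartite in `A`, `Aᶜ` with `|Aᶜ| = |A|`; `S` a set of configuration
symmetries, each the relabelling `configPerm e` by a graph automorphism `e` mapping `A` onto `A`,
or onto `Aᶜ` with `|A| n` even, or the spin flip `flipEquiv` with `|A| n` even;
`rep : κ → configurations` of weight `|Aᶜ| n` meeting every orbit of the group generated by `S` in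
that weight sector; `Φ σ k = 𝟙[σ ∈ orbit (rep k)]` the orbit frame. Then the symmetric block
`K = {v ∈ 𝓗_{Sᶻ=0} | v ∘ g = v ∀ g ∈ S}` is a subspace mapped into itself by `H`, containing the
ground space (Marshall–Lieb–Mattis), containing every `Φ y`, and spanned by the columns of `Φ`
(orbit-indicator expansion). Lieb–Mattis (1962) Thm 2; Marshall (1955).
[cite: LiebMattis1962, Theorem 2] -/
theorem orbitBlock_structure (hG : G.Connected) (hA : G.IsBipartiteWith (A : Set Λ) (↑A)ᶜ)
    (hJ : 0 < J) (hcard : Aᶜ.card = A.card) (S : Set (Equiv.Perm (TensorIndex Λ (n + 1))))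
    (hS : ∀ g ∈ S, (∃ e : Λ ≃ Λ, (∀ x y, G.Adj (e x) (e y) ↔ G.Adj x y) ∧
        ((∀ x, e x ∈ A ↔ x ∈ A) ∨ ((∀ x, e x ∈ A ↔ x ∉ A) ∧ Even (A.card * n))) ∧
        g = configPerm (q := n + 1) e) ∨ (Even (A.card * n) ∧ g = flipEquiv))
    {κ : Type*} [Fintype κ] [DecidableEq κ] (rep : κ → TensorIndex Λ (n + 1))
    (hrepW : ∀ k, (∑ z, (rep k z : ℕ)) = Aᶜ.card * n)
    (hcomplete : ∀ σ : TensorIndex Λ (n + 1), (∑ z, (σ z : ℕ)) = Aᶜ.card * n →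
      ∃ k, σ ∈ MulAction.orbit (Subgroup.closure S) (rep k))
    (Φ : Matrix (TensorIndex Λ (n + 1)) κ ℂ)
    (hΦ : ∀ σ k, Φ σ k =
      (MulAction.orbit (Subgroup.closure S) (rep k)).indicator (fun _ => (1 : ℂ)) σ) :
    ∃ K : Submodule ℂ (TensorIndex Λ (n + 1) → ℂ),
      (∀ v, v ∈ K ↔ v ∈ spinZSector (Λ := Λ) n 0 ∧ ∀ g ∈ S, ∀ σ, v (g σ) = v σ) ∧
      (∀ v ∈ K, heisenbergHamiltonian n G J *ᵥ v ∈ K) ∧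
      (heisenbergHamiltonian n G J).groundSpace ≤ K ∧
      (∀ y, Φ *ᵥ y ∈ K) ∧ (∀ x ∈ K, ∃ y, Φ *ᵥ y = x) := by
  classical
  set H := heisenbergHamiltonian n G J with hHdef
  set W₀ : ℕ := Aᶜ.card * n with hW₀
  have hHherm : H.IsHermitian := heisenbergHamiltonian_isHermitian n G J
  haveI : Nonempty (TensorIndex Λ (n + 1)) := ⟨fun _ => 0⟩
  have hΛ : Fintype.card Λ = A.card + Aᶜ.card := (Finset.card_add_card_compl A).symm
  have h2W : Fintype.card Λ * n = W₀ + W₀ := by rw [hΛ, hW₀, hcard, Nat.add_mul]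
  have hM0 := magnetisation_of_weight_card_compl n A hcard
  -- membership in the `Sᶻ = 0` sector = support on weight `W₀`
  have hsec : ∀ v : TensorIndex Λ (n + 1) → ℂ, v ∈ spinZSector (Λ := Λ) n 0 ↔
      ∀ σ : TensorIndex Λ (n + 1), ¬((∑ z, (σ z : ℕ)) = W₀) → v σ = 0 := by
    intro v
    rw [← hM0]
    exact mem_spinZSector_weight_iff n W₀ v
  -- every generator preserves the weight-`W₀` sector
  have hSW : ∀ g ∈ S, ∀ σ : TensorIndex Λ (n + 1),
      (∑ z, ((g σ) z : ℕ)) = W₀ ↔ (∑ z, (σ z : ℕ)) = W₀ := by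
    intro g hg σ
    rcases hS g hg with ⟨e, -, -, rfl⟩ | ⟨-, rfl⟩
    · rw [configPerm_apply]
      exact Iff.of_eq (congrArg (· = W₀) (Equiv.sum_comp e (fun z => (σ z : ℕ))))
    · have h := weight_flipCfg_add n (flipEquiv σ)
      have h' := weight_flipCfg_add n σ
      change (∑ z, ((flipCfg σ) z : ℕ)) = W₀ ↔ _
      omega
  have hclW : ∀ g ∈ Subgroup.closure S, ∀ σ : TensorIndex Λ (n + 1),
      (∑ z, ((g σ) z : ℕ)) = W₀ ↔ (∑ z, (σ z : ℕ)) = W₀ :=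
    fun g hg σ => iff_perm_of_generators S (fun τ => (∑ z, (τ z : ℕ)) = W₀) hSW hg σ
  -- the symmetric block `K`
  let Fix : Submodule ℂ (TensorIndex Λ (n + 1) → ℂ) :=
    { carrier := {v | ∀ g ∈ S, ∀ σ, v (g σ) = v σ}
      add_mem' := by
        intro a b ha hb g hg σ
        simp only [Pi.add_apply, ha g hg σ, hb g hg σ]
      zero_mem' := by intro g _ σ; rfl
      smul_mem' := by
        intro r v hv g hg σ
        simp only [Pi.smul_apply, hv g hg σ] }
  have hFix : ∀ v, v ∈ Fix ↔ ∀ g ∈ S, ∀ σ, v (g σ) = v σ := fun v => Iff.rfl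
  let K : Submodule ℂ (TensorIndex Λ (n + 1) → ℂ) := spinZSector (Λ := Λ) n 0 ⊓ Fix
  have hK : ∀ v, v ∈ K ↔ v ∈ spinZSector (Λ := Λ) n 0 ∧ ∀ g ∈ S, ∀ σ, v (g σ) = v σ :=
    fun v => Submodule.mem_inf
  -- (1) `H` maps `K` into `K`
  have hKA : ∀ v ∈ K, H *ᵥ v ∈ K := by
    intro v hv
    obtain ⟨hv0, hvS⟩ := (hK v).1 hv
    refine (hK _).2 ⟨heisenberg_mulVec_mem_spinZSector n G J hv0, fun g hg => ?_⟩
    rcases hS g hg with ⟨e, hadj, -, rfl⟩ | ⟨-, rfl⟩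
    · have hve : (permOp e : Op Λ (n + 1)) *ᵥ v = v :=
        (permOp_mulVec_eq_self_iff e v).2 (hvS _ hg)
      have hcomm : (permOp e : Op Λ (n + 1)) * H = H * permOp e :=
        (permOp_mul_eq_mul_permOp_iff e _).2 (reindexOp_heisenbergHamiltonian n G G e hadj J)
      apply (permOp_mulVec_eq_self_iff e (H *ᵥ v)).1
      rw [mulVec_mulVec, hcomm, ← mulVec_mulVec, hve]
    · have hvf : v ∘ flipCfg = v := funext fun σ => hvS _ hg σ
      intro σ
      have h := heisenberg_mulVec_comp_flipCfg G J v
      rw [hvf] at h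
      exact (congrFun h σ).symm
  -- (2) the ground space lies in `K`
  have hGS : H.groundSpace ≤ K := by
    intro ψ hψ
    refine (hK ψ).2 ⟨groundSpace_le_spinZSector_zero n G A J hG hA hJ hcard hψ, fun g hg => ?_⟩
    rcases hS g hg with ⟨e, hadj, hAe | ⟨hAe, hpar⟩, rfl⟩ | ⟨hpar, rfl⟩
    · exact (permOp_mulVec_eq_self_iff e ψ).1
        (permOp_mulVec_eq_self_of_map_eq n G A J hG hA hJ hcard e hadj hAe hψ)
    · exact (permOp_mulVec_eq_self_iff e ψ).1
        (permOp_mulVec_eq_self_of_map_eq_compl n G A J hG hA hJ hcard hpar e hadj hAe hψ)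
    · intro σ
      exact congrFun (groundState_comp_flipCfg n G A J hG hA hJ hcard hpar hψ) σ
  -- (3) the columns of `Φ` lie in `K`
  have hcol : ∀ k, (fun σ => Φ σ k) ∈ K := by
    intro k
    refine (hK _).2 ⟨(hsec _).2 fun σ hσ => ?_, fun g hg σ => ?_⟩
    · rw [hΦ, Set.indicator_of_notMem]
      intro hmem
      obtain ⟨g, rfl⟩ := MulAction.mem_orbit_iff.1 hmem
      rw [Subgroup.smul_def, Equiv.Perm.smul_def] at hσ
      exact hσ ((hclW _ g.2 (rep k)).2 (hrepW k))
    · rw [hΦ, hΦ]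
      have hg' : g ∈ Subgroup.closure S := Subgroup.subset_closure hg
      have hiff : g σ ∈ MulAction.orbit (Subgroup.closure S) (rep k) ↔
          σ ∈ MulAction.orbit (Subgroup.closure S) (rep k) := by
        have := smul_mem_orbit_iff (X := TensorIndex Λ (n + 1)) (⟨g, hg'⟩ : Subgroup.closure S)
          (a := σ) (b := rep k)
        rwa [Subgroup.smul_def, Equiv.Perm.smul_def] at this
      by_cases hσ : σ ∈ MulAction.orbit (Subgroup.closure S) (rep k)
      · rw [Set.indicator_of_mem hσ, Set.indicator_of_mem (hiff.2 hσ)]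
      · rw [Set.indicator_of_notMem hσ, Set.indicator_of_notMem (fun h => hσ (hiff.1 h))]
  have hΦK : ∀ y, Φ *ᵥ y ∈ K := by
    intro y
    have hexp : Φ *ᵥ y = ∑ k, y k • fun σ => Φ σ k := by
      funext σ
      simp only [mulVec, dotProduct, Finset.sum_apply, Pi.smul_apply, smul_eq_mul, mul_comm (y _)]
    rw [hexp]
    exact K.sum_mem fun k _ => K.smul_mem _ (hcol k)
  -- (4) `K` is spanned by the columns of `Φ`
  have hKΦ : ∀ x ∈ K, ∃ y, Φ *ᵥ y = x := by
    intro x hx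
    obtain ⟨hx0, hxS⟩ := (hK x).1 hx
    have hspan := mem_span_orbitIndicator_of_generators S x hxS
    have hle : Submodule.span ℂ ((fun x₀ : TensorIndex Λ (n + 1) =>
        (MulAction.orbit (Subgroup.closure S) x₀).indicator (fun _ => (1 : ℂ))) '' {x₀ | x x₀ ≠ 0}) ≤
        LinearMap.range (Matrix.mulVecLin Φ) := by
      refine Submodule.span_le.2 ?_
      rintro v ⟨x₀, hx₀, rfl⟩
      have hw₀ : (∑ z, (x₀ z : ℕ)) = W₀ := by
        by_contra hne
        exact hx₀ ((hsec x).1 hx0 x₀ hne)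
      obtain ⟨k, hk⟩ := hcomplete x₀ hw₀
      have horb : MulAction.orbit (Subgroup.closure S) x₀ =
          MulAction.orbit (Subgroup.closure S) (rep k) := MulAction.orbit_eq_iff.2 hk
      refine ⟨Pi.single k 1, ?_⟩
      rw [Matrix.mulVecLin_apply]
      funext σ
      beta_reduce
      rw [horb, ← hΦ σ k, mulVec, dotProduct, Finset.sum_eq_single k]
      · simp
      · intro b _ hb
        simp [Pi.single_eq_of_ne hb]
      · simp
    obtain ⟨y, hy⟩ := LinearMap.mem_range.1 (hle hspan)
    exact ⟨y, by rw [← Matrix.mulVecLin_apply]; exact hy⟩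
  exact ⟨K, hK, hKA, hGS, hΦK, hKΦ⟩

/-- **Soundness of the orbit-basis certificate for the Heisenberg antiferromagnet.**
`H = J Σ 𝐒_x·𝐒_y` (`J > 0`) on a connected graph bipartite in `A`, `Aᶜ` with `|Aᶜ| = |A|`; `S` a
set of configuration symmetries, each the relabelling `configPerm e` by a graph automorphism `e`
mapping `A` onto `A`, or onto `Aᶜ` with `|A| n` even, or the spin flip `flipEquiv` with `|A| n`
even; `rep : κ → configurations` of weight `|Aᶜ| n` meeting every orbit of the group generated by
`S` in that weight sector; `Φ σ k = 𝟙[σ ∈ orbit (rep k)]` the orbit frame. Then an exact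
factorisation `Φᴴ H Φ - s Φᴴ Φ = L diag(d) Lᴴ` with all pivots but one nonnegative and the
Rayleigh data `‖Φc‖² = N > 0`, `Re⟨Φc, HΦc⟩ = ρ N`, `‖HΦc‖² ≤ (r2 + ρ²) N`, `ρ < s` prove
`ρ - r2/(s-ρ) ≤ E₀(H) ≤ ρ`, uniqueness of the ground state `ψ₀` (which lies in the symmetric
block), `ω₀(O) = ⟨ψ₀, Oψ₀⟩`, and `(N - |⟨ψ₀, Φc⟩|²)(s-ρ)² ≤ r2 N`. Kato (1949) Thm 1;
Lieb–Mattis (1962) Thm 2; Marshall (1955). [cite: LiebMattis1962, Theorem 2] -/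
theorem orbitBlock_certificate (hG : G.Connected) (hA : G.IsBipartiteWith (A : Set Λ) (↑A)ᶜ)
    (hJ : 0 < J) (hcard : Aᶜ.card = A.card) (S : Set (Equiv.Perm (TensorIndex Λ (n + 1))))
    (hS : ∀ g ∈ S, (∃ e : Λ ≃ Λ, (∀ x y, G.Adj (e x) (e y) ↔ G.Adj x y) ∧
        ((∀ x, e x ∈ A ↔ x ∈ A) ∨ ((∀ x, e x ∈ A ↔ x ∉ A) ∧ Even (A.card * n))) ∧
        g = configPerm (q := n + 1) e) ∨ (Even (A.card * n) ∧ g = flipEquiv))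
    {κ : Type*} [Fintype κ] [DecidableEq κ] (rep : κ → TensorIndex Λ (n + 1))
    (hrepW : ∀ k, (∑ z, (rep k z : ℕ)) = Aᶜ.card * n)
    (hcomplete : ∀ σ : TensorIndex Λ (n + 1), (∑ z, (σ z : ℕ)) = Aᶜ.card * n →
      ∃ k, σ ∈ MulAction.orbit (Subgroup.closure S) (rep k))
    (Φ : Matrix (TensorIndex Λ (n + 1)) κ ℂ)
    (hΦ : ∀ σ k, Φ σ k =
      (MulAction.orbit (Subgroup.closure S) (rep k)).indicator (fun _ => (1 : ℂ)) σ)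
    {s : ℝ} (L : Matrix κ κ ℂ) (d : κ → ℝ) (j : κ)
    (hfac : Φᴴ * heisenbergHamiltonian n G J * Φ - (s : ℂ) • (Φᴴ * Φ) =
      L * diagonal (fun i => (d i : ℂ)) * Lᴴ)
    (hd : ∀ i, i ≠ j → 0 ≤ d i) (c : κ → ℂ) {N ρ r2 : ℝ} (hN : 0 < N)
    (hwN : (star (Φ *ᵥ c) ⬝ᵥ (Φ *ᵥ c)).re = N)
    (hρ : (star (Φ *ᵥ c) ⬝ᵥ heisenbergHamiltonian n G J *ᵥ (Φ *ᵥ c)).re = ρ * N)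
    (hr2 : (star (heisenbergHamiltonian n G J *ᵥ (Φ *ᵥ c)) ⬝ᵥ
      heisenbergHamiltonian n G J *ᵥ (Φ *ᵥ c)).re ≤ (r2 + ρ ^ 2) * N) (hρs : ρ < s) :
    ρ - r2 / (s - ρ) ≤ (heisenbergHamiltonian n G J).groundEnergy ∧
      (heisenbergHamiltonian n G J).groundEnergy ≤ ρ ∧
      (heisenbergHamiltonian n G J).HasUniqueGroundState ∧
      ∃ ψ : TensorIndex Λ (n + 1) → ℂ,
        (ψ ∈ spinZSector (Λ := Λ) n 0 ∧ ∀ g ∈ S, ∀ σ, ψ (g σ) = ψ σ) ∧ star ψ ⬝ᵥ ψ = 1 ∧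
        heisenbergHamiltonian n G J *ᵥ ψ =
          (((heisenbergHamiltonian n G J).groundEnergy : ℝ) : ℂ) • ψ ∧
        (∀ O, (heisenbergHamiltonian n G J).groundStateFunctional O = star ψ ⬝ᵥ O *ᵥ ψ) ∧
        (N - ‖star ψ ⬝ᵥ (Φ *ᵥ c)‖ ^ 2) * (s - ρ) ^ 2 ≤ r2 * N := by
  haveI : Nonempty (TensorIndex Λ (n + 1)) := ⟨fun _ => 0⟩
  obtain ⟨K, hK, hKA, hGS, hΦK, hKΦ⟩ :=
    orbitBlock_structure n G A J hG hA hJ hcard S hS rep hrepW hcomplete Φ hΦ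
  obtain ⟨hlo, hhi, huniq, ψ, hψK, hψ1, hHψ, hfun, hover⟩ :=
    groundState_enclosure_of_block_certificate (heisenbergHamiltonian_isHermitian n G J) K hKA hGS Φ
      hΦK hKΦ L d j hfac hd c hN hwN hρ hr2 hρs
  exact ⟨hlo, hhi, huniq, ψ, (hK ψ).1 hψK, hψ1, hHψ, hfun, hover⟩

/-- **Lower bound on `E₀` from the orbit-block PSD (inertia-zero) certificate (Heisenberg
antiferromagnet).** Under the symmetry hypotheses of `orbitBlock_structure`, an exact factorisation
`Φᴴ H Φ - s Φᴴ Φ = L diag(d) Lᴴ` with ALL pivots `≥ 0` proves `s ≤ E₀(H)`; together with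
`orbitBlock_certificate` (or any Rayleigh quotient) this is the two-sided Sturm/inertia enclosure
of the ground energy used by symmetry-reduced exact diagonalisation. [cite: LiebMattis1962, Theorem 2] -/
theorem orbitBlock_psd_lower (hG : G.Connected) (hA : G.IsBipartiteWith (A : Set Λ) (↑A)ᶜ)
    (hJ : 0 < J) (hcard : Aᶜ.card = A.card) (S : Set (Equiv.Perm (TensorIndex Λ (n + 1))))
    (hS : ∀ g ∈ S, (∃ e : Λ ≃ Λ, (∀ x y, G.Adj (e x) (e y) ↔ G.Adj x y) ∧
        ((∀ x, e x ∈ A ↔ x ∈ A) ∨ ((∀ x, e x ∈ A ↔ x ∉ A) ∧ Even (A.card * n))) ∧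
        g = configPerm (q := n + 1) e) ∨ (Even (A.card * n) ∧ g = flipEquiv))
    {κ : Type*} [Fintype κ] [DecidableEq κ] (rep : κ → TensorIndex Λ (n + 1))
    (hrepW : ∀ k, (∑ z, (rep k z : ℕ)) = Aᶜ.card * n)
    (hcomplete : ∀ σ : TensorIndex Λ (n + 1), (∑ z, (σ z : ℕ)) = Aᶜ.card * n →
      ∃ k, σ ∈ MulAction.orbit (Subgroup.closure S) (rep k))
    (Φ : Matrix (TensorIndex Λ (n + 1)) κ ℂ)
    (hΦ : ∀ σ k, Φ σ k =
      (MulAction.orbit (Subgroup.closure S) (rep k)).indicator (fun _ => (1 : ℂ)) σ)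
    {s : ℝ} (L : Matrix κ κ ℂ) (d : κ → ℝ)
    (hfac : Φᴴ * heisenbergHamiltonian n G J * Φ - (s : ℂ) • (Φᴴ * Φ) =
      L * diagonal (fun i => (d i : ℂ)) * Lᴴ)
    (hd : ∀ i, 0 ≤ d i) : s ≤ (heisenbergHamiltonian n G J).groundEnergy := by
  haveI : Nonempty (TensorIndex Λ (n + 1)) := ⟨fun _ => 0⟩
  obtain ⟨K, -, -, hGS, -, hKΦ⟩ :=
    orbitBlock_structure n G A J hG hA hJ hcard S hS rep hrepW hcomplete Φ hΦ
  exact groundEnergy_ge_of_block_psd_certificate (heisenbergHamiltonian_isHermitian n G J) K hGS Φ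
    hKΦ L d hfac hd

/-- **Ground-state expectations from the orbit-basis certificate (Heisenberg antiferromagnet).**
Under the hypotheses of `orbitBlock_certificate`, for an observable `O` with
`|⟨x, (O - m) x⟩| ≤ h ‖x‖²` (e.g. a diagonal correlator, `TempleKato.diagonal_form_bound`) and
`r2 ≤ β² (s-ρ)²`, `β ≥ 0`: `|Re ω₀(O) - Re⟨Φc, O Φc⟩ / N| ≤ 2 h (β + β²)`.
[cite: LiebMattis1962, Theorem 2] -/
theorem orbitBlock_expectation_certificate (hG : G.Connected)
    (hA : G.IsBipartiteWith (A : Set Λ) (↑A)ᶜ) (hJ : 0 < J) (hcard : Aᶜ.card = A.card)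
    (S : Set (Equiv.Perm (TensorIndex Λ (n + 1))))
    (hS : ∀ g ∈ S, (∃ e : Λ ≃ Λ, (∀ x y, G.Adj (e x) (e y) ↔ G.Adj x y) ∧
        ((∀ x, e x ∈ A ↔ x ∈ A) ∨ ((∀ x, e x ∈ A ↔ x ∉ A) ∧ Even (A.card * n))) ∧
        g = configPerm (q := n + 1) e) ∨ (Even (A.card * n) ∧ g = flipEquiv))
    {κ : Type*} [Fintype κ] [DecidableEq κ] (rep : κ → TensorIndex Λ (n + 1))
    (hrepW : ∀ k, (∑ z, (rep k z : ℕ)) = Aᶜ.card * n)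
    (hcomplete : ∀ σ : TensorIndex Λ (n + 1), (∑ z, (σ z : ℕ)) = Aᶜ.card * n →
      ∃ k, σ ∈ MulAction.orbit (Subgroup.closure S) (rep k))
    (Φ : Matrix (TensorIndex Λ (n + 1)) κ ℂ)
    (hΦ : ∀ σ k, Φ σ k =
      (MulAction.orbit (Subgroup.closure S) (rep k)).indicator (fun _ => (1 : ℂ)) σ)
    {s : ℝ} (L : Matrix κ κ ℂ) (d : κ → ℝ) (j : κ)
    (hfac : Φᴴ * heisenbergHamiltonian n G J * Φ - (s : ℂ) • (Φᴴ * Φ) =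
      L * diagonal (fun i => (d i : ℂ)) * Lᴴ)
    (hd : ∀ i, i ≠ j → 0 ≤ d i) (c : κ → ℂ) {N ρ r2 : ℝ} (hN : 0 < N)
    (hwN : (star (Φ *ᵥ c) ⬝ᵥ (Φ *ᵥ c)).re = N)
    (hρ : (star (Φ *ᵥ c) ⬝ᵥ heisenbergHamiltonian n G J *ᵥ (Φ *ᵥ c)).re = ρ * N)
    (hr2 : (star (heisenbergHamiltonian n G J *ᵥ (Φ *ᵥ c)) ⬝ᵥ
      heisenbergHamiltonian n G J *ᵥ (Φ *ᵥ c)).re ≤ (r2 + ρ ^ 2) * N) (hρs : ρ < s)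
    {O : Op Λ (n + 1)} {m h β : ℝ}
    (hOform : ∀ x, ‖star x ⬝ᵥ O *ᵥ x - (m : ℂ) * (star x ⬝ᵥ x)‖ ≤ h * (star x ⬝ᵥ x).re)
    (hβ : 0 ≤ β) (hβr : r2 ≤ β ^ 2 * (s - ρ) ^ 2) :
    |((heisenbergHamiltonian n G J).groundStateFunctional O).re -
        (star (Φ *ᵥ c) ⬝ᵥ O *ᵥ (Φ *ᵥ c)).re / N| ≤ 2 * h * (β + β ^ 2) := by
  haveI : Nonempty (TensorIndex Λ (n + 1)) := ⟨fun _ => 0⟩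
  obtain ⟨-, -, -, ψ, -, hψ1, -, hfun, hover⟩ := orbitBlock_certificate n G A J hG hA hJ hcard S hS
    rep hrepW hcomplete Φ hΦ L d j hfac hd c hN hwN hρ hr2 hρs
  rw [hfun O]
  -- normalise the trial vector and use the mixing estimate
  set w := Φ *ᵥ c with hw
  have hw0 : w ≠ 0 := by
    rintro h0
    rw [h0, dotProduct_zero, Complex.zero_re] at hwN
    exact hN.ne' hwN.symm
  obtain ⟨a, ha, haa, ha1⟩ := exists_normalize hw0
  rw [hwN] at haa
  have hσρ : 0 < (s - ρ) ^ 2 := by have := sub_pos.2 hρs; positivity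
  have hover' : 1 - ‖star ((a : ℂ) • w) ⬝ᵥ ψ‖ ^ 2 ≤ β ^ 2 := by
    have hsym : ‖star ((a : ℂ) • w) ⬝ᵥ ψ‖ ^ 2 = a * a * ‖star ψ ⬝ᵥ w‖ ^ 2 := by
      rw [star_dotProduct, norm_star, dotProduct_smul, norm_smul, Complex.norm_real,
        Real.norm_of_nonneg ha.le, mul_pow, sq a]
    rw [hsym]
    have h1 : (1 - a * a * ‖star ψ ⬝ᵥ w‖ ^ 2) * (s - ρ) ^ 2 ≤ β ^ 2 * (s - ρ) ^ 2 := by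
      have := mul_le_mul_of_nonneg_left hover (mul_self_nonneg a)
      have h' : a * a * ((N - ‖star ψ ⬝ᵥ w‖ ^ 2) * (s - ρ) ^ 2) =
          (1 - a * a * ‖star ψ ⬝ᵥ w‖ ^ 2) * (s - ρ) ^ 2 := by
        have : a * a * N = 1 := haa
        nlinarith
      have h'' : a * a * (r2 * N) = r2 := by
        calc a * a * (r2 * N) = r2 * (a * a * N) := by ring
          _ = r2 := by rw [haa, mul_one]
      rw [h', h''] at this
      exact this.trans hβr
    exact le_of_mul_le_mul_right h1 hσρ
  have hmain := abs_expect_sub_expect_le hOform hψ1 ha1 hβ hover'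
  rw [mulVec_smul, star_real_smul_dotProduct_real_smul, Complex.re_ofReal_mul] at hmain
  have hdiv : (star w ⬝ᵥ O *ᵥ w).re / N = a * a * (star w ⬝ᵥ O *ᵥ w).re := by
    rw [div_eq_iff hN.ne', mul_comm (a * a), mul_assoc, haa, mul_one]
  rw [hdiv]
  exact hmain

/-- **Orbit-block certificate with the trial vector given in the full basis (implementation "H"
shape).** As `orbitBlock_certificate`, but the trial vector is any `w` of the `Sᶻ = 0` sector that
is EXACTLY invariant under the generators (e.g. the integer symmetrisation `Σ_g g·v` of a Lanczos
vector), with its Rayleigh data `‖w‖² = N`, `Re⟨w,Hw⟩ = ρN`, `‖Hw‖² ≤ (r2 + ρ²)N`; the gap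
certificate is still the block `LDLᴴ` factorisation in the orbit frame `Φ`. (Temple's inequality
with `σ ≤ λ₂` of the TRIVIAL BLOCK is legitimate only because `w` lies in that block and the
ground state does — Marshall–Lieb–Mattis; `λ₂` of the whole `Sᶻ = 0` sector may be smaller.)
[cite: LiebMattis1962, Theorem 2] -/
theorem orbitBlock_certificate_of_invariant (hG : G.Connected)
    (hA : G.IsBipartiteWith (A : Set Λ) (↑A)ᶜ) (hJ : 0 < J) (hcard : Aᶜ.card = A.card)
    (S : Set (Equiv.Perm (TensorIndex Λ (n + 1))))
    (hS : ∀ g ∈ S, (∃ e : Λ ≃ Λ, (∀ x y, G.Adj (e x) (e y) ↔ G.Adj x y) ∧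
        ((∀ x, e x ∈ A ↔ x ∈ A) ∨ ((∀ x, e x ∈ A ↔ x ∉ A) ∧ Even (A.card * n))) ∧
        g = configPerm (q := n + 1) e) ∨ (Even (A.card * n) ∧ g = flipEquiv))
    {κ : Type*} [Fintype κ] [DecidableEq κ] (rep : κ → TensorIndex Λ (n + 1))
    (hrepW : ∀ k, (∑ z, (rep k z : ℕ)) = Aᶜ.card * n)
    (hcomplete : ∀ σ : TensorIndex Λ (n + 1), (∑ z, (σ z : ℕ)) = Aᶜ.card * n →
      ∃ k, σ ∈ MulAction.orbit (Subgroup.closure S) (rep k))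
    (Φ : Matrix (TensorIndex Λ (n + 1)) κ ℂ)
    (hΦ : ∀ σ k, Φ σ k =
      (MulAction.orbit (Subgroup.closure S) (rep k)).indicator (fun _ => (1 : ℂ)) σ)
    {s : ℝ} (L : Matrix κ κ ℂ) (d : κ → ℝ) (j : κ)
    (hfac : Φᴴ * heisenbergHamiltonian n G J * Φ - (s : ℂ) • (Φᴴ * Φ) =
      L * diagonal (fun i => (d i : ℂ)) * Lᴴ)
    (hd : ∀ i, i ≠ j → 0 ≤ d i) (w : TensorIndex Λ (n + 1) → ℂ)
    (hw0 : w ∈ spinZSector (Λ := Λ) n 0) (hwS : ∀ g ∈ S, ∀ σ, w (g σ) = w σ)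
    {N ρ r2 : ℝ} (hN : 0 < N) (hwN : (star w ⬝ᵥ w).re = N)
    (hρ : (star w ⬝ᵥ heisenbergHamiltonian n G J *ᵥ w).re = ρ * N)
    (hr2 : (star (heisenbergHamiltonian n G J *ᵥ w) ⬝ᵥ heisenbergHamiltonian n G J *ᵥ w).re ≤
      (r2 + ρ ^ 2) * N) (hρs : ρ < s) :
    ρ - r2 / (s - ρ) ≤ (heisenbergHamiltonian n G J).groundEnergy ∧
      (heisenbergHamiltonian n G J).groundEnergy ≤ ρ ∧
      (heisenbergHamiltonian n G J).HasUniqueGroundState ∧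
      ∃ ψ : TensorIndex Λ (n + 1) → ℂ,
        (ψ ∈ spinZSector (Λ := Λ) n 0 ∧ ∀ g ∈ S, ∀ σ, ψ (g σ) = ψ σ) ∧ star ψ ⬝ᵥ ψ = 1 ∧
        heisenbergHamiltonian n G J *ᵥ ψ =
          (((heisenbergHamiltonian n G J).groundEnergy : ℝ) : ℂ) • ψ ∧
        (∀ O, (heisenbergHamiltonian n G J).groundStateFunctional O = star ψ ⬝ᵥ O *ᵥ ψ) ∧
        (N - ‖star ψ ⬝ᵥ w‖ ^ 2) * (s - ρ) ^ 2 ≤ r2 * N := by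
  haveI : Nonempty (TensorIndex Λ (n + 1)) := ⟨fun _ => 0⟩
  obtain ⟨K, hK, -, -, -, hKΦ⟩ :=
    orbitBlock_structure n G A J hG hA hJ hcard S hS rep hrepW hcomplete Φ hΦ
  obtain ⟨c, hc⟩ := hKΦ w ((hK w).2 ⟨hw0, hwS⟩)
  rw [← hc] at hwN hρ hr2
  have h := orbitBlock_certificate n G A J hG hA hJ hcard S hS rep hrepW hcomplete Φ hΦ L d j hfac
    hd c hN hwN hρ hr2 hρs
  rwa [hc] at h

/-- **Ground-state expectations, trial vector in the full basis (implementation "H" shape).**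
Under the hypotheses of `orbitBlock_certificate_of_invariant`, for an observable `O` with
`|⟨x, (O - m) x⟩| ≤ h ‖x‖²` and `r2 ≤ β² (s-ρ)²`, `β ≥ 0`:
`|Re ω₀(O) - Re⟨w, O w⟩ / N| ≤ 2 h (β + β²)`. [cite: LiebMattis1962, Theorem 2] -/
theorem orbitBlock_expectation_certificate_of_invariant (hG : G.Connected)
    (hA : G.IsBipartiteWith (A : Set Λ) (↑A)ᶜ) (hJ : 0 < J) (hcard : Aᶜ.card = A.card)
    (S : Set (Equiv.Perm (TensorIndex Λ (n + 1))))
    (hS : ∀ g ∈ S, (∃ e : Λ ≃ Λ, (∀ x y, G.Adj (e x) (e y) ↔ G.Adj x y) ∧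
        ((∀ x, e x ∈ A ↔ x ∈ A) ∨ ((∀ x, e x ∈ A ↔ x ∉ A) ∧ Even (A.card * n))) ∧
        g = configPerm (q := n + 1) e) ∨ (Even (A.card * n) ∧ g = flipEquiv))
    {κ : Type*} [Fintype κ] [DecidableEq κ] (rep : κ → TensorIndex Λ (n + 1))
    (hrepW : ∀ k, (∑ z, (rep k z : ℕ)) = Aᶜ.card * n)
    (hcomplete : ∀ σ : TensorIndex Λ (n + 1), (∑ z, (σ z : ℕ)) = Aᶜ.card * n →
      ∃ k, σ ∈ MulAction.orbit (Subgroup.closure S) (rep k))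
    (Φ : Matrix (TensorIndex Λ (n + 1)) κ ℂ)
    (hΦ : ∀ σ k, Φ σ k =
      (MulAction.orbit (Subgroup.closure S) (rep k)).indicator (fun _ => (1 : ℂ)) σ)
    {s : ℝ} (L : Matrix κ κ ℂ) (d : κ → ℝ) (j : κ)
    (hfac : Φᴴ * heisenbergHamiltonian n G J * Φ - (s : ℂ) • (Φᴴ * Φ) =
      L * diagonal (fun i => (d i : ℂ)) * Lᴴ)
    (hd : ∀ i, i ≠ j → 0 ≤ d i) (w : TensorIndex Λ (n + 1) → ℂ)
    (hw0 : w ∈ spinZSector (Λ := Λ) n 0) (hwS : ∀ g ∈ S, ∀ σ, w (g σ) = w σ)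
    {N ρ r2 : ℝ} (hN : 0 < N) (hwN : (star w ⬝ᵥ w).re = N)
    (hρ : (star w ⬝ᵥ heisenbergHamiltonian n G J *ᵥ w).re = ρ * N)
    (hr2 : (star (heisenbergHamiltonian n G J *ᵥ w) ⬝ᵥ heisenbergHamiltonian n G J *ᵥ w).re ≤
      (r2 + ρ ^ 2) * N) (hρs : ρ < s)
    {O : Op Λ (n + 1)} {m h β : ℝ}
    (hOform : ∀ x, ‖star x ⬝ᵥ O *ᵥ x - (m : ℂ) * (star x ⬝ᵥ x)‖ ≤ h * (star x ⬝ᵥ x).re)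
    (hβ : 0 ≤ β) (hβr : r2 ≤ β ^ 2 * (s - ρ) ^ 2) :
    |((heisenbergHamiltonian n G J).groundStateFunctional O).re - (star w ⬝ᵥ O *ᵥ w).re / N| ≤
      2 * h * (β + β ^ 2) := by
  haveI : Nonempty (TensorIndex Λ (n + 1)) := ⟨fun _ => 0⟩
  obtain ⟨K, hK, -, -, -, hKΦ⟩ :=
    orbitBlock_structure n G A J hG hA hJ hcard S hS rep hrepW hcomplete Φ hΦ
  obtain ⟨c, hc⟩ := hKΦ w ((hK w).2 ⟨hw0, hwS⟩)
  rw [← hc] at hwN hρ hr2 ⊢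
  exact orbitBlock_expectation_certificate n G A J hG hA hJ hcard S hS rep hrepW hcomplete Φ hΦ L d
    j hfac hd c hN hwN hρ hr2 hρs hOform hβ hβr

end LiebMattis

end Literature.MathematicalPhysics.QuantumLattice

end
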